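import Mathlib
import Literature.Combinatorics.Additive.TripleProductProperty
import Literature.Combinatorics.Additive.ArithmeticRemoval
import Literature.Combinatorics.Additive.ArithmeticRemovalProofs
import Summits.MatrixMultiplication.MatrixMultiplication.Theses.AutomaticSTPPDesigns
import Summits.MatrixMultiplication.MatrixMultiplication.Theorems.AutomaticSTPPDesignsSingleAutomatonRigidityStubMassSq
import Summits.MatrixMultiplication.MatrixMultiplication.Theorems.AutomaticSTPPDesignsSingleAutomatonRigidityStubZeroSumCard
import Summits.MatrixMultiplication.MatrixMultiplication.Theorems.AutomaticSTPPDesignsSingleAutomatonRigidityStubBlockCover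
import Summits.MatrixMultiplication.MatrixMultiplication.Theorems.AutomaticSTPPDesignsSingleAutomatonRigidityStubDiffDisjoint
import Summits.MatrixMultiplication.MatrixMultiplication.Theorems.AutomaticSTPPDesignsSingleAutomatonRigidityStubAmgm3
import Summits.MatrixMultiplication.MatrixMultiplication.Theorems.AutomaticSTPPDesignsSingleAutomatonRigidityStubLiveReduction

/-!
# `SingleAutomatonRigidity` — no STPP family is within a constant of the packing bound

Route `MatrixMultiplication/AutomaticSTPPDesigns`, crux `stmt-MatrixMultiplication-7359`
(`Summit.MatrixMultiplication.MatrixMultiplication.Theses.AutomaticSTPPDesigns.SingleAutomatonRigidity`):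
for every base `p ≥ 2` and every triple of regular languages whose all-scales family of blocks is
an STPP family (CKSU 2005, Def. 5.1; the tree's `AddSimultaneousTPP`) in every `ℤ/(p^k)`, the
packing functional at the critical exponent is `o(p^k)`:
`∀ c > 0, ∃ k₀, ∀ k ≥ k₀, ∑_w (|A_w||B_w||C_w|)^{2/3} ≤ c p^k`.

LINE `Sketch` (crux cards `difference-set-removal` / `green-removal-min-mass`, same lever). The crux
follows from a UNIFORM single-scale statement over all finite abelian groups `H` (`|H| = N`) and all
STPP families `(Aᵢ, Bᵢ, Cᵢ)ᵢ` (`uniformCriticalPackingDecay`): for every `c > 0`,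
`∑ᵢ (|Aᵢ||Bᵢ||Cᵢ|)^{2/3} < c N` once `N ≥ N₀(c)`. Regularity of the languages and the all-scales
hypothesis are NOT used; `2 ≤ p` only makes `p^k → ∞`.

Proof of the uniform statement for live families (all blocks nonempty; `stub_liveDecay`), with
`xᵢ = |Aᵢ||Bᵢ||Cᵢ|`:
* the block-difference sets `D = ⋃ᵢ (Aᵢ - Bᵢ)`, `E = ⋃ᵢ (Bᵢ - Cᵢ)`, `F = ⋃ᵢ (Cᵢ - Aᵢ)` have only
  DIAGONAL zero-sum triples `(a - b, b - c, c - a)` (one-clause STPP read backwards,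
  `stub_zeroSumCard`), hence at most `∑ᵢ xᵢ ≤ N^{3/2} ≤ δ N²` of them for `N ≥ δ⁻²`
  (`stub_massSq`: Cauchy–Schwarz over the three packing bounds
  `AddSimultaneousTPP.sum_card_mul_card_le` and its cyclic rotations `addSimultaneousTPP_rotate`);
* Green's arithmetic removal lemma (`Literature.Combinatorics.Additive.Green2005_1_5_holds`, `k = 3`,
  proved in tree) deletes `≤ ε N` elements `R_D, R_E, R_F` from `D, E, F` and kills all zero-sums;
* so every block triple `(a, b, c) ∈ Aᵢ × Bᵢ × Cᵢ` is hit (`a - b ∈ R_D ∨ b - c ∈ R_E ∨ c - a ∈ R_F`);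
  inside block `i` a deleted difference lies on at most `|Cᵢ|` (resp. `|Aᵢ|`, `|Bᵢ|`) triples
  (`stub_blockCover`) and the `Aᵢ - Bᵢ` are pairwise disjoint (`stub_diffDisjoint`), whence
  `∑ᵢ mᵢ ≤ |R_D| + |R_E| + |R_F| ≤ 3 ε N` for the min pair product
  `mᵢ = min(|Aᵢ||Bᵢ|, |Bᵢ||Cᵢ|, |Cᵢ||Aᵢ|)` (`min_le_of_cover`);
* weighted AM–GM (`stub_amgm3`, `rpow_two_thirds_le`):
  `xᵢ^{2/3} = (λ²mᵢ · P/λ · P'/λ)^{1/3} ≤ (λ² mᵢ + (|Aᵢ||Bᵢ| + |Bᵢ||Cᵢ| + |Cᵢ||Aᵢ|)/λ)/3`, summed: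
  `∑ xᵢ^{2/3} ≤ λ² ε N + N/λ = (c/2 + c/6) N < c N` for `λ = 6/c`, `ε = c³/72`.
Dead blocks contribute `0` and the live sub-family is again STPP (`stub_liveReduction`), and the
transfer to the crux instantiates `H := ZMod (p ^ k)`, `k₀ := N₀(c)` (`p ^ k ≥ 2 ^ k ≥ k`).

Nearest print precedent: K. Pratt, arXiv:2309.03878, Cor. 2.9 (one packing sum of an STPP family is
`o(|G|)`, from group removal); Blasiak–Church–Cohn–Grochow–Naslund–Sawin–Umans 2017, Thm. 3.3 (the
same reduction fed to slice rank). No definitions; closes item stmt-MatrixMultiplication-7359.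
-/

-- the tree's namespace `Summit.MatrixMultiplication.MatrixMultiplication.…` repeats a component by
-- design
set_option linter.dupNamespace false

namespace Summit.MatrixMultiplication.MatrixMultiplication.Theorems

open Finset
open Literature.Combinatorics.Additive

namespace SingleAutomatonRigidity


/-- Cyclic symmetry of the STPP in an abelian group: `(A, B, C) ↦ (B, C, A)`. -/
theorem addSimultaneousTPP_rotate {H : Type*} [AddCommGroup H] {ι : Type*} {A B C : ι → Finset H}
    (hS : AddSimultaneousTPP A B C) : AddSimultaneousTPP B C A := by
  rw [addSimultaneousTPP_iff_forall] at hS ⊢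
  intro i j k t ht t' ht' u hu u' hu' s hs s' hs' h0
  have h1 : s' - s + (t' - t) + (u' - u) = 0 := by rw [← h0]; abel
  obtain ⟨hki, hij, hs_, ht_, hu_⟩ := hS k i j s hs s' hs' t ht t' ht' u hu u' hu' h1
  exact ⟨hij, (hki.trans hij).symm, ht_, hu_, hs_⟩

/-- Per-block weighted hitting count: if `x = |A||B||C| > 0` is covered as in `stub_blockCover`,
the min pair product is at most the number of deleted differences of the block. -/
theorem min_le_of_cover (a b c rD rE rF : ℕ) (ha : 0 < a) (hb : 0 < b) (hc : 0 < c)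
    (hcov : a * b * c ≤ rD * c + rE * a + rF * b) :
    min (a * b) (min (b * c) (c * a)) ≤ rD + rE + rF := by
  set m := min (a * b) (min (b * c) (c * a)) with hm
  have h1 : m ≤ a * b := min_le_left _ _
  have h2 : m ≤ b * c := (min_le_right _ _).trans (min_le_left _ _)
  have h3 : m ≤ c * a := (min_le_right _ _).trans (min_le_right _ _)
  have hx : 0 < a * b * c := by positivity
  refine Nat.le_of_mul_le_mul_left ?_ hx
  calc a * b * c * m = m * (a * b * c) := by ring
    _ ≤ m * (rD * c + rE * a + rF * b) := Nat.mul_le_mul_left _ hcov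
    _ = m * c * rD + m * a * rE + m * b * rF := by ring
    _ ≤ a * b * c * rD + b * c * a * rE + c * a * b * rF := by
        gcongr
    _ = a * b * c * (rD + rE + rF) := by ring

/-- Per-block weighted AM–GM at the critical exponent. -/
theorem rpow_two_thirds_le (a b c : ℕ) (L : ℝ) (hL : 0 < L) :
    (((a * b * c : ℕ) : ℝ)) ^ ((2 : ℝ) / 3) ≤
      (L ^ 2 * ((min (a * b) (min (b * c) (c * a)) : ℕ) : ℝ) +
        ((a * b + b * c + c * a : ℕ) : ℝ) / L) / 3 := by
  have hab : (0 : ℝ) ≤ (a * b : ℕ) := by positivity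
  have hbc : (0 : ℝ) ≤ (b * c : ℕ) := by positivity
  have hca : (0 : ℝ) ≤ (c * a : ℕ) := by positivity
  have hx : (((a * b * c : ℕ) : ℝ)) ^ ((2 : ℝ) / 3) =
      (((a * b : ℕ) : ℝ) * ((b * c : ℕ) : ℝ) * ((c * a : ℕ) : ℝ)) ^ ((1 : ℝ) / 3) := by
    rw [show ((2 : ℝ) / 3) = 2 * ((1 : ℝ) / 3) by norm_num, Real.rpow_mul (by positivity),
      Real.rpow_two]
    congr 1
    push_cast
    ring
  rw [hx]
  have hsum : ∀ y z : ℝ, 0 ≤ y → 0 ≤ z → y + z ≤ ((a * b + b * c + c * a : ℕ) : ℝ) →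
      y / L + z / L ≤ ((a * b + b * c + c * a : ℕ) : ℝ) / L := by
    intro y z _ _ hyz
    rw [← add_div]
    exact div_le_div_of_nonneg_right hyz hL.le
  rcases min_choice (a * b) (min (b * c) (c * a)) with h | h
  · rw [h]
    calc _ ≤ (L ^ 2 * ((a * b : ℕ) : ℝ) + ((b * c : ℕ) : ℝ) / L + ((c * a : ℕ) : ℝ) / L) / 3 :=
          stub_amgm3 _ _ _ L hab hbc hca hL
      _ ≤ _ := by
          have := hsum _ _ hbc hca (by push_cast; nlinarith)
          linarith
  · rw [h]
    rcases min_choice (b * c) (c * a) with h' | h'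
    · rw [h']
      calc _ = (((b * c : ℕ) : ℝ) * ((c * a : ℕ) : ℝ) * ((a * b : ℕ) : ℝ)) ^ ((1 : ℝ) / 3) := by
            ring_nf
        _ ≤ (L ^ 2 * ((b * c : ℕ) : ℝ) + ((c * a : ℕ) : ℝ) / L + ((a * b : ℕ) : ℝ) / L) / 3 :=
            stub_amgm3 _ _ _ L hbc hca hab hL
        _ ≤ _ := by
            have := hsum _ _ hca hab (by push_cast; nlinarith)
            linarith
    · rw [h']
      calc _ = (((c * a : ℕ) : ℝ) * ((a * b : ℕ) : ℝ) * ((b * c : ℕ) : ℝ)) ^ ((1 : ℝ) / 3) := by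
            ring_nf
        _ ≤ (L ^ 2 * ((c * a : ℕ) : ℝ) + ((a * b : ℕ) : ℝ) / L + ((b * c : ℕ) : ℝ) / L) / 3 :=
            stub_amgm3 _ _ _ L hca hab hbc hL
        _ ≤ _ := by
            have := hsum _ _ hab hbc (by push_cast; nlinarith)
            linarith

/-- **Uniform critical packing decay, live families**. -/
theorem stub_liveDecay (c : ℝ) (hc : 0 < c) :
    ∃ N₀ : ℕ, ∀ (H : Type) [AddCommGroup H] [Fintype H], N₀ ≤ Fintype.card H →
      ∀ (ι : Type) [Fintype ι] (A B C : ι → Finset H),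
        (∀ i, (A i).Nonempty ∧ (B i).Nonempty ∧ (C i).Nonempty) → AddSimultaneousTPP A B C →
          ∑ i, (((A i).card * (B i).card * (C i).card : ℕ) : ℝ) ^ ((2 : ℝ) / 3) <
            c * (Fintype.card H : ℝ) := by
  -- constants
  set L : ℝ := 6 / c with hL
  have hLpos : 0 < L := by positivity
  set ε : ℝ := c ^ 3 / 72 with hε
  have hεpos : 0 < ε := by positivity
  obtain ⟨δ, hδ, hrem⟩ := Green2005_1_5_holds 3 le_rfl ε hεpos
  refine ⟨⌈1 / δ ^ 2⌉₊ + 1, ?_⟩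
  intro H _ _ hN ι _ A B C hlive hS
  classical
  set N : ℕ := Fintype.card H with hNdef
  have hNpos : (0 : ℝ) < N := by exact_mod_cast (show 0 < N by omega)
  have hNδ : (1 : ℝ) ≤ δ ^ 2 * N := by
    have h1 : (⌈1 / δ ^ 2⌉₊ : ℝ) < N := by exact_mod_cast (show ⌈1 / δ ^ 2⌉₊ < N by omega)
    have h2 : 1 / δ ^ 2 ≤ (⌈1 / δ ^ 2⌉₊ : ℝ) := Nat.le_ceil _
    have hδ2 : 0 < δ ^ 2 := by positivity
    rw [div_le_iff₀ hδ2] at h2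
    nlinarith
  -- nonemptiness and the three packing bounds
  have hA : ∀ i, (A i).Nonempty := fun i => (hlive i).1
  have hB : ∀ i, (B i).Nonempty := fun i => (hlive i).2.1
  have hC : ∀ i, (C i).Nonempty := fun i => (hlive i).2.2
  have hS' : AddSimultaneousTPP B C A := addSimultaneousTPP_rotate hS
  have hS'' : AddSimultaneousTPP C A B := addSimultaneousTPP_rotate hS'
  have hPab : ∑ i, (A i).card * (B i).card ≤ N := hS.sum_card_mul_card_le hC
  have hPbc : ∑ i, (B i).card * (C i).card ≤ N := hS'.sum_card_mul_card_le hA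
  have hPca : ∑ i, (C i).card * (A i).card ≤ N := hS''.sum_card_mul_card_le hB
  -- the three block-difference sets
  set D : Finset H := univ.biUnion fun i => image₂ (· - ·) (A i) (B i) with hD
  set E : Finset H := univ.biUnion fun i => image₂ (· - ·) (B i) (C i) with hE
  set F : Finset H := univ.biUnion fun i => image₂ (· - ·) (C i) (A i) with hF
  -- few zero-sums
  have hmass : (∑ i, (A i).card * (B i).card * (C i).card) ^ 2 ≤ N ^ 3 :=
    stub_massSq (fun i => (A i).card) (fun i => (B i).card) (fun i => (C i).card) N hPab hPbc hPca
  have hzero : ((((Fintype.piFinset ![D, E, F]).filter fun g => ∑ j, g j = 0).card : ℕ) : ℝ) ≤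
      δ * (Fintype.card H : ℝ) ^ (3 - 1) := by
    have h1 := stub_zeroSumCard A B C hS
    have h3 : ((∑ i, (A i).card * (B i).card * (C i).card : ℕ) : ℝ) ^ 2 ≤ (N : ℝ) ^ 3 := by
      exact_mod_cast hmass
    have h4 : (N : ℝ) ^ 3 ≤ (δ * (N : ℝ) ^ 2) ^ 2 := by
      have : (δ * (N : ℝ) ^ 2) ^ 2 = (δ ^ 2 * N) * (N : ℝ) ^ 3 := by ring
      rw [this]
      nlinarith [pow_nonneg hNpos.le 3]
    have h2 : ((∑ i, (A i).card * (B i).card * (C i).card : ℕ) : ℝ) ≤ δ * (N : ℝ) ^ 2 :=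
      (pow_le_pow_iff_left₀ (by positivity) (by positivity) two_ne_zero).1 (h3.trans h4)
    calc ((((Fintype.piFinset ![D, E, F]).filter fun g => ∑ j, g j = 0).card : ℕ) : ℝ)
        ≤ ((∑ i, (A i).card * (B i).card * (C i).card : ℕ) : ℝ) := by exact_mod_cast h1
      _ ≤ δ * (N : ℝ) ^ 2 := h2
      _ = δ * (Fintype.card H : ℝ) ^ (3 - 1) := by norm_num [hNdef]
  -- removal
  obtain ⟨A', hsub, hsmall, hfree⟩ := hrem H ![D, E, F] hzero
  set RD : Finset H := D \ A' 0 with hRD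
  set RE : Finset H := E \ A' 1 with hRE
  set RF : Finset H := F \ A' 2 with hRF
  have hRDle : (RD.card : ℝ) ≤ ε * N := by simpa using hsmall 0
  have hREle : (RE.card : ℝ) ≤ ε * N := by simpa using hsmall 1
  have hRFle : (RF.card : ℝ) ≤ ε * N := by simpa using hsmall 2
  -- every block triple is hit
  have hhit : ∀ i, ∀ a ∈ A i, ∀ b ∈ B i, ∀ c ∈ C i, a - b ∈ RD ∨ b - c ∈ RE ∨ c - a ∈ RF := by
    intro i a ha b hb x hx
    by_contra hcon
    push Not at hcon
    obtain ⟨h1, h2, h3⟩ := hcon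
    have hdD : a - b ∈ D := mem_biUnion.2 ⟨i, mem_univ _, mem_image₂_of_mem ha hb⟩
    have heE : b - x ∈ E := mem_biUnion.2 ⟨i, mem_univ _, mem_image₂_of_mem hb hx⟩
    have hfF : x - a ∈ F := mem_biUnion.2 ⟨i, mem_univ _, mem_image₂_of_mem hx ha⟩
    have g1 : a - b ∈ A' 0 := by by_contra h'; exact h1 (mem_sdiff.2 ⟨hdD, h'⟩)
    have g2 : b - x ∈ A' 1 := by by_contra h'; exact h2 (mem_sdiff.2 ⟨heE, h'⟩)
    have g3 : x - a ∈ A' 2 := by by_contra h'; exact h3 (mem_sdiff.2 ⟨hfF, h'⟩)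
    have hmem : ![a - b, b - x, x - a] ∈ Fintype.piFinset A' := by
      rw [Fintype.mem_piFinset]
      intro j
      fin_cases j
      · simpa using g1
      · simpa using g2
      · simpa using g3
    refine hfree _ hmem ?_
    rw [Fin.sum_univ_three]
    simp only [Matrix.cons_val_zero, Matrix.cons_val_one, Matrix.cons_val]
    abel
  -- per-block cover and the weighted hitting count
  have hmin : ∀ i, min ((A i).card * (B i).card) (min ((B i).card * (C i).card)
      ((C i).card * (A i).card)) ≤ (RD ∩ image₂ (· - ·) (A i) (B i)).card +
        (RE ∩ image₂ (· - ·) (B i) (C i)).card + (RF ∩ image₂ (· - ·) (C i) (A i)).card := by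
    intro i
    refine min_le_of_cover _ _ _ _ _ _ (hA i).card_pos (hB i).card_pos (hC i).card_pos ?_
    exact stub_blockCover (A i) (B i) (C i) (hS.addTripleProductProperty i) RD RE RF (hhit i)
  have hsumD : ∑ i, (RD ∩ image₂ (· - ·) (A i) (B i)).card ≤ RD.card := by
    rw [← card_biUnion]
    · exact card_le_card (biUnion_subset.2 fun i _ => inter_subset_left)
    · intro i _ j _ hij
      exact (stub_diffDisjoint A B C hS hC hij).mono inter_subset_right inter_subset_right
  have hsumE : ∑ i, (RE ∩ image₂ (· - ·) (B i) (C i)).card ≤ RE.card := by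
    rw [← card_biUnion]
    · exact card_le_card (biUnion_subset.2 fun i _ => inter_subset_left)
    · intro i _ j _ hij
      exact (stub_diffDisjoint B C A hS' hA hij).mono inter_subset_right inter_subset_right
  have hsumF : ∑ i, (RF ∩ image₂ (· - ·) (C i) (A i)).card ≤ RF.card := by
    rw [← card_biUnion]
    · exact card_le_card (biUnion_subset.2 fun i _ => inter_subset_left)
    · intro i _ j _ hij
      exact (stub_diffDisjoint C A B hS'' hB hij).mono inter_subset_right inter_subset_right
  have hminsum : ((∑ i, min ((A i).card * (B i).card) (min ((B i).card * (C i).card)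
      ((C i).card * (A i).card)) : ℕ) : ℝ) ≤ 3 * ε * N := by
    have h1 : ∑ i, min ((A i).card * (B i).card) (min ((B i).card * (C i).card)
        ((C i).card * (A i).card)) ≤ RD.card + RE.card + RF.card := by
      calc _ ≤ ∑ i, ((RD ∩ image₂ (· - ·) (A i) (B i)).card +
            (RE ∩ image₂ (· - ·) (B i) (C i)).card + (RF ∩ image₂ (· - ·) (C i) (A i)).card) :=
            sum_le_sum fun i _ => hmin i
        _ = _ := by rw [sum_add_distrib, sum_add_distrib]
        _ ≤ RD.card + RE.card + RF.card := by gcongr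
    have h2 : ((∑ i, min ((A i).card * (B i).card) (min ((B i).card * (C i).card)
        ((C i).card * (A i).card)) : ℕ) : ℝ) ≤ ((RD.card + RE.card + RF.card : ℕ) : ℝ) :=
      Nat.cast_le.2 h1
    rw [Nat.cast_add, Nat.cast_add] at h2
    linarith
  -- pair-product mass
  have hσ : ((∑ i, ((A i).card * (B i).card + (B i).card * (C i).card +
      (C i).card * (A i).card) : ℕ) : ℝ) ≤ 3 * N := by
    have : ∑ i, ((A i).card * (B i).card + (B i).card * (C i).card + (C i).card * (A i).card)
        ≤ N + N + N := by
      rw [sum_add_distrib, sum_add_distrib]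
      gcongr
    have h' : ((∑ i, ((A i).card * (B i).card + (B i).card * (C i).card +
        (C i).card * (A i).card) : ℕ) : ℝ) ≤ ((N + N + N : ℕ) : ℝ) := Nat.cast_le.2 this
    rw [Nat.cast_add, Nat.cast_add] at h'
    linarith
  -- weighted AM–GM, summed
  have hkey : ∑ i, (((A i).card * (B i).card * (C i).card : ℕ) : ℝ) ^ ((2 : ℝ) / 3) ≤
      (L ^ 2 * ((∑ i, min ((A i).card * (B i).card) (min ((B i).card * (C i).card)
          ((C i).card * (A i).card)) : ℕ) : ℝ) +
        ((∑ i, ((A i).card * (B i).card + (B i).card * (C i).card +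
          (C i).card * (A i).card) : ℕ) : ℝ) / L) / 3 := by
    calc _ ≤ ∑ i, (L ^ 2 * ((min ((A i).card * (B i).card) (min ((B i).card * (C i).card)
          ((C i).card * (A i).card)) : ℕ) : ℝ) +
        (((A i).card * (B i).card + (B i).card * (C i).card + (C i).card * (A i).card : ℕ) : ℝ)
          / L) / 3 := sum_le_sum fun i _ => rpow_two_thirds_le _ _ _ L hLpos
      _ = _ := by
        rw [← sum_div, sum_add_distrib, ← mul_sum, ← sum_div]
        push_cast
        ring
  -- arithmetic
  have hL2e : L ^ 2 * ε = c / 2 := by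
    rw [hL, hε]; field_simp; ring
  have h1L : 1 / L = c / 6 := by rw [hL]; field_simp
  have hfin : (L ^ 2 * ((∑ i, min ((A i).card * (B i).card) (min ((B i).card * (C i).card)
          ((C i).card * (A i).card)) : ℕ) : ℝ) +
        ((∑ i, ((A i).card * (B i).card + (B i).card * (C i).card +
          (C i).card * (A i).card) : ℕ) : ℝ) / L) / 3 ≤ (L ^ 2 * (3 * ε * N) + 3 * N / L) / 3 := by
    gcongr
  have hval : (L ^ 2 * (3 * ε * N) + 3 * N / L) / 3 = (c / 2) * N + (c / 6) * N := by
    have : (L ^ 2 * (3 * ε * N) + 3 * N / L) / 3 = (L ^ 2 * ε) * N + (1 / L) * N := by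
      field_simp
    rw [this, hL2e, h1L]
  calc _ ≤ _ := hkey
    _ ≤ _ := hfin
    _ = (c / 2) * N + (c / 6) * N := hval
    _ < c * (Fintype.card H : ℝ) := by rw [← hNdef]; nlinarith

end SingleAutomatonRigidity

/-! ## Composition -/

open SingleAutomatonRigidity in
/-- **Uniform critical packing decay** (all finite abelian groups, all STPP families, one scale):
for every `c > 0` there is `N₀` such that `∑ᵢ (|Aᵢ||Bᵢ||Cᵢ|)^{2/3} < c |H|` for every STPP family
(CKSU 2005, Def. 5.1) in a finite abelian group `H` with `|H| ≥ N₀` — no STPP family is within a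
constant of the packing bound at the critical exponent `2/3` (cf. Pratt, arXiv:2309.03878, Cor. 2.9). -/
theorem uniformCriticalPackingDecay (c : ℝ) (hc : 0 < c) :
    ∃ N₀ : ℕ, ∀ (H : Type) [AddCommGroup H] [Fintype H], N₀ ≤ Fintype.card H →
      ∀ (ι : Type) [Fintype ι] (A B C : ι → Finset H), AddSimultaneousTPP A B C →
        ∑ i, (((A i).card * (B i).card * (C i).card : ℕ) : ℝ) ^ ((2 : ℝ) / 3) <
          c * (Fintype.card H : ℝ) := by
  obtain ⟨N₀, hN₀⟩ := stub_liveDecay c hc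
  refine ⟨N₀, fun H _ _ hN ι _ A B C hS => ?_⟩
  exact stub_liveReduction A B C hS c fun κ _ A' B' C' hl hS' => hN₀ H hN κ A' B' C' hl hS'

/-- **The crux** `SingleAutomatonRigidity` (stmt-MatrixMultiplication-7359): for every base `p ≥ 2`
and every triple of (regular) languages whose all-scales family is STPP in every `ℤ/(p^k)`, the
packing functional at the critical exponent is `o(p^k)`:
`∀ c > 0, ∃ k₀, ∀ k ≥ k₀, ∑_w (|A_w||B_w||C_w|)^{2/3} ≤ c p^k`. Transfer from
`uniformCriticalPackingDecay` with `H := ZMod (p ^ k)` and `k₀ := N₀(c)` (`p ^ k ≥ 2 ^ k ≥ k`);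
regularity is not used. -/
theorem singleAutomatonRigidity_proof :
    Summit.MatrixMultiplication.MatrixMultiplication.Theses.AutomaticSTPPDesigns.SingleAutomatonRigidity := by
  unfold Summit.MatrixMultiplication.MatrixMultiplication.Theses.AutomaticSTPPDesigns.SingleAutomatonRigidity
  intro p ι _ LA LB LC hp _hA _hB _hC blk hS c hc
  obtain ⟨N₀, hN₀⟩ := uniformCriticalPackingDecay c hc
  refine ⟨N₀, fun k hk => ?_⟩
  haveI : NeZero (p ^ k) := ⟨pow_ne_zero _ (by omega)⟩
  have hcard : N₀ ≤ Fintype.card (ZMod (p ^ k)) := by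
    rw [ZMod.card]
    calc N₀ ≤ k := hk
      _ ≤ 2 ^ k := Nat.lt_two_pow_self.le
      _ ≤ p ^ k := Nat.pow_le_pow_left hp k
  have key := hN₀ (ZMod (p ^ k)) hcard (Fin k → ι) (blk k LA) (blk k LB) (blk k LC) (hS k)
  rw [ZMod.card, Nat.cast_pow] at key
  exact key.le

end Summit.MatrixMultiplication.MatrixMultiplication.Theorems
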